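import Literature.AlgebraicGeometry.Resolution.ToricChartsExhaustion
import HarnessLib

/-!
# Independence of the Abhyankar basis (Temkin 2013, Prop. 5.4.3) — proved

Topic: `Literature/AlgebraicGeometry/Resolution`. M. Temkin, *Inseparable local uniformization*,
J. Algebra 373 (2013) 65–119 = arXiv:0804.1554v3 (numbers and pages of this version), §5.4,
Prop. 5.4.3 (p. 57): "Let `B` and `B'` be two Abhyankar bases. Then for any sufficiently large
toric monoid `M ⊂ Λ°` the local rings `A_M` and `A'_M` in `K` coincide, and for any
`m ∈ M ∩ Λ_B ∩ Λ_{B'}` one has that `i_B(m) = u i_{B'}(m)` for a unit `u ∈ A_M^×`." This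
file DISCHARGES the named fact `Temkin2013_Prop543` (`AbhyankarToroidalCharts.lean`, where the
vocabulary — `toricChart`, `nrAlg`, `centreLocalRing`, `IsToricMonoid`, `IsAbhyankarBasis` — and
the rendering are documented): `Temkin2013_Prop543_holds`.

The proof given here is NOT the printed one (pp. 57–59: birational fibres of the local rings
in the Riemann–Zariski space `P_K`, constructible sets `S₁`, `S₂` cut out by
`|i_{B'}(a_j)/i_B(a_j)| = 1` and by liftings of residue fields, compactness of the constructible
topology, Lemma 5.4.4 with [EGA IV₄ 17.7.8]) but a direct algebraic one resting on Cor. 5.4.2,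
which the tree PROVES
(`exists_isToricMonoid_forall_mem_centreLocalRing`, `ToricChartsExhaustion.lean`: finitely many
elements of `K°` lie in `A_{B,M}` for all sufficiently large `M`):

* `A_M = A_{B,M}` is a ring of fractions `a/b`, `|b| = 1`, of the normal ring `Nr_K(k[M_B])`,
  so its elements of value `1` are units (`inv_mem_centreLocalRing_of_valuation_eq_one`) and it
  is integrally closed in `K` (`mem_centreLocalRing_of_isIntegral`,
  `mem_nrAlg_of_isIntegral_nrAlg`).
* The pairs of exponents `(d, d') ∈ ℤ^E × ℤ^{E'}` with `|x^d| = |x'^{d'}|` (i.e. the elements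
  `m ∈ Λ_B ∩ Λ_{B'}`, `i_B(m) = x^d`, `i_{B'}(m) = x'^{d'}`) form a subgroup `H` of
  `ℤ^E × ℤ^{E'}`, finitely generated as `ℤ` is Noetherian; the "unit" `u(d, d') = x'^{d'}/x^d` is
  multiplicative in `(d, d')` (`lmonomial_div_sum_zsmul`), so all `u(h)`, `h ∈ H`, lie in a
  subalgebra as soon as the `u(gᵢ)^{±1}` of finitely many generators `gᵢ` do
  (`prod_zpow_mem_of_inv_mem`).
* KEY (`centreLocalRing_le_of_mem`): if `A_M` contains `B'_F`, `B'_F⁻¹` and all `u(h)`, then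
  `A'_M ⊆ A_M`. Indeed a monomial `x'^{d'}` of `k[M_{B'}]` has value `m ∈ M`; some power `mⁿ`,
  `n > 0`, lies in `Λ_B` (`B` is an Abhyankar basis), `mⁿ = |x^d|`, so `(d, n d') ∈ H` and
  `x'^{n d'} = u · x^d ∈ A_M` (`|x^d| = mⁿ ∈ M`); hence `x'^{d'}`, a root of `Tⁿ − x'^{nd'}`, lies
  in the integrally closed `A_M`. So `k[M_{B'}] ⊆ A_M`, then `Nr_K(k[M_{B'}]) ⊆ A_M`, then
  `A'_M ⊆ A_M` (value-one denominators are units of `A_M`).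
* Cor. 5.4.2 for `B` (resp. `B'`) and the finite set `{y'ᵢ^{±1}, u(gₗ)^{±1}}` (resp.
  `{yᵢ^{±1}, u(gₗ)^{±1}}`) gives thresholds `M₁`, `M₂`; toric monoids in `Λ°` are directed
  (`exists_isToricMonoid_ge_ge`, from Thm. A.2.1 `exists_basis_lt_one_subset_closure` and
  `isToricMonoid_closure_basis`), so one toric `M₀ ⊇ M₁ ∪ M₂` works: for every toric
  `M₀ ⊆ M ⊆ Λ°`, `A_M = A'_M`, and `i_B(m) = u i_{B'}(m)` with `u = u(d, d')⁻¹ ∈ A_M^×`.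

## Sources

* M. Temkin, *Inseparable local uniformization*, arXiv:0804.1554v3: §5.3 (pp. 54–56), §5.4,
  Cor. 5.4.2 and Prop. 5.4.3 (p. 57), Thm. A.2.1 (p. 63).
-/

noncomputable section

namespace Literature.AlgebraicGeometry.Resolution

open IsLocalRing ValuationSubring

universe u

variable {k K : Type u} [Field k] [Field K] [Algebra k K] (O : ValuationSubring K)

/-! ### The local rings `A = N_𝔭`: units and integral closedness -/

section LocalRing

variable {O}

/-- Elements of value `1` of the local ring `A = {a/b : a, b ∈ N, |b| = 1}` are units of `A`
(`A ⊆ K°` is the local ring of the centre of `K°`). [folklore] -/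
theorem inv_mem_centreLocalRing_of_valuation_eq_one {N : Subalgebra k K} {z : K}
    (hz : z ∈ centreLocalRing O N) (hz1 : O.valuation z = 1) :
    z⁻¹ ∈ centreLocalRing O N := by
  obtain ⟨a, ha, b, hb, hb1, rfl⟩ := hz
  rw [map_div₀, hb1, div_one] at hz1
  exact inv_mem_centreLocalRing ha hb hz1

/-- In a subalgebra of a field, `z, z⁻¹ ∈ A ⇒ zⁿ ∈ A` for all `n ∈ ℤ`. [folklore] -/
theorem zpow_mem_of_inv_mem {A : Subalgebra k K} {z : K} (hz : z ∈ A) (hz' : z⁻¹ ∈ A)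
    (n : ℤ) : z ^ n ∈ A := by
  cases n with
  | ofNat n => rw [Int.ofNat_eq_natCast, zpow_natCast]; exact A.pow_mem hz n
  | negSucc n => rw [zpow_negSucc, ← inv_pow]; exact A.pow_mem hz' _

/-- `Nr_K(C)` is integrally closed in `K` (transitivity of integrality). [folklore] -/
theorem mem_nrAlg_of_isIntegral_nrAlg {C : Subalgebra k K} {z : K} (hz : IsIntegral (nrAlg C) z) :
    z ∈ nrAlg C := by
  haveI : Algebra.IsIntegral C (nrAlg C) := ⟨fun w =>
    (isIntegral_algHom_iff (IsScalarTower.toAlgHom C (nrAlg C) K) (fun a b h => Subtype.ext h)).mp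
      w.2⟩
  exact mem_nrAlg_iff.mpr (isIntegral_trans (R := C) z hz)

/-- If `N ⊆ K` is integrally closed in `K`, so is its local ring
`A = {a/b : a, b ∈ N, |b| = 1}`: an integral equation over `A` becomes, after clearing the
value-one common denominator `Q` of its coefficients, an integral equation for `Qz` over `N`.
[folklore] -/
theorem mem_centreLocalRing_of_isIntegral {N : Subalgebra k K}
    (hN : ∀ z : K, IsIntegral N z → z ∈ N) {z : K}
    (hz : IsIntegral (centreLocalRing O N) z) : z ∈ centreLocalRing O N := by
  classical
  obtain ⟨p, hpm, hpz⟩ := hz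
  have hc : ∀ i : ℕ, ∃ a ∈ N, ∃ b ∈ N, O.valuation b = 1 ∧
      ((p.coeff i : centreLocalRing O N) : K) = a / b := fun i => (p.coeff i).2
  choose a ha b hb hb1 hab using hc
  have hb0 : ∀ i, b i ≠ 0 := fun i h => by simpa [h] using hb1 i
  set Q : K := ∏ i ∈ Finset.range p.natDegree, b i with hQ
  have hQN : Q ∈ N := Subalgebra.prod_mem _ fun i _ => hb i
  have hQ1 : O.valuation Q = 1 := by
    rw [hQ, map_prod]
    exact Finset.prod_eq_one fun i _ => hb1 i
  have hQ0 : Q ≠ 0 := fun h => by simp [h] at hQ1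
  have hQz : IsIntegral N (Q * z) := by
    refine isIntegral_mul_of_monic_of_coeff_mul_pow_mem N hpm hpz fun i hi => ?_
    obtain ⟨m, hm⟩ : ∃ m, p.natDegree - i = m + 1 :=
      Nat.exists_eq_succ_of_ne_zero (Nat.sub_ne_zero_of_lt hi)
    rw [hm, pow_succ', ← mul_assoc]
    refine Subalgebra.mul_mem _ ?_ (Subalgebra.pow_mem _ hQN _)
    rw [show algebraMap (centreLocalRing O N) K (p.coeff i) = a i / b i from hab i, hQ,
      ← Finset.mul_prod_erase _ _ (Finset.mem_range.mpr hi), ← mul_assoc,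
      div_mul_cancel₀ _ (hb0 i)]
    exact Subalgebra.mul_mem _ (ha i) (Subalgebra.prod_mem _ fun l _ => hb l)
  rw [show z = Q * z / Q by field_simp]
  exact div_mem_centreLocalRing (hN _ hQz) hQN hQ1

/-- Hence the local rings `A_{B,M}` of the toroidal models are integrally closed in `K`.
[folklore] -/
theorem mem_centreLocalRing_nrAlg_of_isIntegral {C : Subalgebra k K} {z : K}
    (hz : IsIntegral (centreLocalRing O (nrAlg C)) z) : z ∈ centreLocalRing O (nrAlg C) :=
  mem_centreLocalRing_of_isIntegral (fun _ hw => mem_nrAlg_of_isIntegral_nrAlg hw) hz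

end LocalRing

/-! ### Values of Laurent monomials and the lattice `Λ_B` -/

section Monomials

variable {κ : Type*} (x : κ → K)

/-- The elements of `Λ_B`, the subgroup of `Λ` generated by the values `|xⱼ|`, are the values of
the Laurent monomials `x^d`, `d ∈ ℤ^κ` (the map `i_B` of §5.3, p. 55). [folklore] -/
theorem exists_lmonomial_of_mem_closure (hx0 : ∀ j, x j ≠ 0) {γ : (ValueGroup O)ˣ}
    (hγ : γ ∈ Subgroup.closure (Set.range fun j =>
      Units.mk0 (O.valuation (x j)) (valuation_ne_zero_of_ne_zero O (hx0 j)))) :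
    ∃ d : κ →₀ ℤ, (γ : ValueGroup O) = O.valuation (d.prod fun j (n : ℤ) => x j ^ n) := by
  induction hγ using Subgroup.closure_induction with
  | mem γ h =>
    obtain ⟨j, rfl⟩ := h
    exact ⟨Finsupp.single j 1, by rw [lmonomial_single, zpow_one, Units.val_mk0]⟩
  | one => exact ⟨0, by rw [Finsupp.prod_zero_index, map_one, Units.val_one]⟩
  | mul a b _ _ iha ihb =>
    obtain ⟨d, hd⟩ := iha
    obtain ⟨d', hd'⟩ := ihb
    exact ⟨d + d', by rw [Units.val_mul, hd, hd', lmonomial_add x hx0, map_mul]⟩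
  | inv a _ ih =>
    obtain ⟨d, hd⟩ := ih
    exact ⟨-d, by rw [Units.val_inv_eq_inv_val, hd, lmonomial_neg x hx0, map_inv₀]⟩

end Monomials

/-! ### The units `i_{B'}(m) / i_B(m)` as Laurent monomials in finitely many of them -/

section Ratio

variable {O} {κ κ' : Type*} (x : κ → K) (x' : κ' → K) (hx0 : ∀ j, x j ≠ 0)
  (hx'0 : ∀ j, x' j ≠ 0)
include hx0 hx'0

/-- The "units" `u(d, d') = x'^{d'} / x^d` (Temkin 2013, Prop. 5.4.3: "`i_B(m) = u i_{B'}(m)`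
for a unit `u`") are multiplicative in the pair of exponent vectors `(d, d') ∈ ℤ^κ × ℤ^{κ'}`: for
a `ℤ`-combination `∑ cᵢ gᵢ` of pairs, `u(∑ cᵢ gᵢ) = ∏ u(gᵢ)^{cᵢ}`. [folklore] -/
theorem lmonomial_div_sum_zsmul {r : ℕ} (g : Fin r → (κ →₀ ℤ) × (κ' →₀ ℤ)) (c : Fin r → ℤ)
    (p : (κ →₀ ℤ) × (κ' →₀ ℤ)) (hp : ∑ i, c i • g i = p) :
    (p.2.prod fun j (n : ℤ) => x' j ^ n) / (p.1.prod fun j (n : ℤ) => x j ^ n) =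
      ∏ i, (((g i).2.prod fun j (n : ℤ) => x' j ^ n) /
        (g i).1.prod fun j (n : ℤ) => x j ^ n) ^ c i := by
  subst hp
  rw [Prod.fst_sum, Prod.snd_sum, lmonomial_sum x hx0, lmonomial_sum x' hx'0,
    ← Finset.prod_div_distrib]
  refine Finset.prod_congr rfl fun i _ => ?_
  rw [Prod.smul_fst, Prod.smul_snd, lmonomial_zsmul x hx0, lmonomial_zsmul x' hx'0, div_zpow]

omit hx0 hx'0 in
/-- A product of integer powers of elements `wᵢ` with `wᵢ^{±1} ∈ A` lies in the subalgebra
`A`. [folklore] -/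
theorem prod_zpow_mem_of_inv_mem {A : Subalgebra k K} {r : ℕ} {w : Fin r → K}
    (hw : ∀ i, w i ∈ A ∧ (w i)⁻¹ ∈ A) (c : Fin r → ℤ) : ∏ i, w i ^ c i ∈ A :=
  Subalgebra.prod_mem _ fun i _ => zpow_mem_of_inv_mem (hw i).1 (hw i).2 _

end Ratio

/-! ### Directedness of the toric monoids in `Λ°` -/

section Directed

/-- **Toric monoids in `Λ°` are directed** (Temkin 2013, §5.3, p. 55: "`Λ°` is a filtered union
of its free submonoids; in particular, those are cofinal in the family of toric submonoids of
`Λ°`", Thm. A.2.1): for a finitely generated Abhyankar `K/k`, any two toric (indeed any two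
finitely generated) monoids `M₁, M₂ ⊆ Λ°` lie in a common toric monoid `M₀ ⊆ Λ°` with
`M₀^gp = Λ`. PROVED from `exists_basis_lt_one_subset_closure` (`PerronTransforms.lean`) and
`isToricMonoid_closure_basis`.
[cite: Temkin2013, Section 5.3 (p. 55) and Thm. A.2.1 (p. 63 of arXiv:0804.1554v3)] -/
theorem exists_isToricMonoid_ge_ge (hfg : (⊤ : IntermediateField k K).FG)
    (hk : ∀ c : k, algebraMap k K c ∈ O) (hD : transcendenceDefect k O hk = 0)
    {M₁ M₂ : Submonoid (ValueGroup O)ˣ} (h₁ : M₁.FG) (h₁le : M₁ ≤ valuationMonoid O)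
    (h₂ : M₂.FG) (h₂le : M₂ ≤ valuationMonoid O) :
    ∃ M₀ : Submonoid (ValueGroup O)ˣ, IsToricMonoid O M₀ ∧ M₀ ≤ valuationMonoid O ∧
      M₁ ≤ M₀ ∧ M₂ ≤ M₀ := by
  classical
  haveI : Group.FG (ValueGroup O)ˣ := valueGroup_fg_of_transcendenceDefect_eq_zero O hfg hk hD
  obtain ⟨S₁, hS₁⟩ := h₁
  obtain ⟨S₂, hS₂⟩ := h₂
  have hS : ∀ s ∈ S₁ ∪ S₂, s ≤ 1 := by
    intro s hs
    rw [← Units.val_le_val, Units.val_one, ← mem_valuationMonoid_iff]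
    rcases Finset.mem_union.mp hs with hs | hs
    · exact h₁le (hS₁ ▸ Submonoid.subset_closure hs)
    · exact h₂le (hS₂ ▸ Submonoid.subset_closure hs)
  obtain ⟨n, b, -, hsub, hle1⟩ := exists_basis_lt_one_subset_closure (S₁ ∪ S₂) hS
  refine ⟨_, isToricMonoid_closure_basis O b, fun m hm => ?_, ?_, ?_⟩
  · exact (mem_valuationMonoid_iff O).mpr (Units.val_le_val.mpr (hle1 m hm))
  · rw [← hS₁]
    exact Submonoid.closure_le.mpr fun s hs => hsub (Finset.mem_union_left _ hs)
  · rw [← hS₂]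
    exact Submonoid.closure_le.mpr fun s hs => hsub (Finset.mem_union_right _ hs)

end Directed

/-! ### The key inclusion `A'_M ⊆ A_M` -/

section Key

variable {O}

/-- **Key step of Prop. 5.4.3**: if the local ring `A_M = A_{B,M}` of the toroidal model of an
Abhyankar basis `B = x ⊔ y` contains the elements `y'ᵢ^{±1}` of `B'_F` and the units
`u(d, d') = x'^{d'}/x^d` for all pairs of monomials of equal value, then it contains
`A'_M = A_{B',M}`: every monomial `x'^{d'}` of `k[M_{B'}]` has a power `x'^{nd'} = u · x^d`
with `|x^d| = |x'^{d'}|ⁿ ∈ M` (some power of every value lies in `Λ_B`), so it is integral over,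
hence in, `A_M`; then `k[M_{B'}] ⊆ A_M`, `Nr_K(k[M_{B'}]) ⊆ A_M` (integral closedness) and
`A'_M ⊆ A_M` (value-one elements of `A_M` are units).
[cite: Temkin2013, Prop. 5.4.3 (p. 57 of arXiv:0804.1554v3)] -/
theorem centreLocalRing_le_of_mem {hk : ∀ c : k, algebraMap k K c ∈ O} {κ ι κ' ι' : Type*}
    {x : κ → K} {y : ι → O} {x' : κ' → K} {y' : ι' → O} (hB : IsAbhyankarBasis O hk x y)
    (hx'0 : ∀ j, x' j ≠ 0) (M : Submonoid (ValueGroup O)ˣ)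
    (hy' : ∀ i, (y' i : K) ∈ centreLocalRing O (nrAlg (toricChart (k := k) O x y M)) ∧
      (y' i : K)⁻¹ ∈ centreLocalRing O (nrAlg (toricChart (k := k) O x y M)))
    (hr : ∀ (d : κ →₀ ℤ) (d' : κ' →₀ ℤ),
      O.valuation (d.prod fun j (n : ℤ) => x j ^ n) =
        O.valuation (d'.prod fun j (n : ℤ) => x' j ^ n) →
      (d'.prod fun j (n : ℤ) => x' j ^ n) / (d.prod fun j (n : ℤ) => x j ^ n) ∈
        centreLocalRing O (nrAlg (toricChart (k := k) O x y M))) :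
    centreLocalRing O (nrAlg (toricChart (k := k) O x' y' M)) ≤
      centreLocalRing O (nrAlg (toricChart (k := k) O x y M)) := by
  set A := centreLocalRing O (nrAlg (toricChart (k := k) O x y M)) with hA
  have hAint : ∀ z, IsIntegral A z → z ∈ A := fun z hz =>
    mem_centreLocalRing_nrAlg_of_isIntegral hz
  have hCA : toricChart (k := k) O x y M ≤ A := (le_nrAlg _).trans (le_centreLocalRing _)
  -- Step 1: `k[M_{B'}] ⊆ A`
  have h1 : toricChart (k := k) O x' y' M ≤ A := by
    refine Algebra.adjoin_le ?_
    rintro m ((⟨i, rfl⟩ | ⟨i, rfl⟩) | ⟨⟨γ, hγM, hγ⟩, d', rfl⟩)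
    · exact (hy' i).1
    · exact (hy' i).2
    · obtain ⟨n, hn, hmem⟩ := hB.exists_pow_mem_closure γ
      obtain ⟨d, hd⟩ := exists_lmonomial_of_mem_closure O x hB.ne_zero hmem
      have hrel : O.valuation (d.prod fun j (n : ℤ) => x j ^ n) =
          O.valuation ((n • d').prod fun j (n : ℤ) => x' j ^ n) := by
        rw [← hd, lmonomial_nsmul x' hx'0, map_pow, ← hγ, Units.val_pow_eq_pow_val]
      have hxd : (d.prod fun j (n : ℤ) => x j ^ n) ∈ A :=
        hCA (lmonomial_mem_toricChart x y d ⟨γ ^ n, pow_mem hγM n, hd⟩)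
      have hpow : (d'.prod fun j (n : ℤ) => x' j ^ n) ^ n ∈ A := by
        have h := A.mul_mem (hr _ _ hrel) hxd
        rwa [lmonomial_nsmul x' hx'0, div_mul_cancel₀ _ (lmonomial_ne_zero x hB.ne_zero d)] at h
      refine hAint _ ⟨Polynomial.X ^ n - Polynomial.C ⟨_, hpow⟩,
        Polynomial.monic_X_pow_sub_C _ hn.ne', ?_⟩
      simp only [Polynomial.eval₂_sub, Polynomial.eval₂_X_pow, Polynomial.eval₂_C]
      exact sub_self _
  -- Step 2: `Nr_K(k[M_{B'}]) ⊆ A`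
  have h2 : nrAlg (toricChart (k := k) O x' y' M) ≤ A := fun z hz =>
    hAint z (mem_nrAlg_iff.mp (nrAlg_mono h1 hz))
  -- Step 3: fractions with denominators of value one
  rintro _ ⟨a, ha, b, hb, hb1, rfl⟩
  rw [div_eq_mul_inv]
  exact A.mul_mem (h2 ha) (inv_mem_centreLocalRing_of_valuation_eq_one (h2 hb) hb1)

end Key

/-! ### Prop. 5.4.3 -/

/-- **Temkin 2013, Prop. 5.4.3 (independence of the Abhyankar basis)** — the named fact
`Temkin2013_Prop543` of `AbhyankarToroidalCharts.lean`, DISCHARGED (p. 57: "Let `B` and `B'` be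
two Abhyankar bases. Then for any sufficiently large toric monoid `M ⊂ Λ°` the local rings `A_M`
and `A'_M` in `K` coincide, and for any `m ∈ M ∩ Λ_B ∩ Λ_{B'}` one has that
`i_B(m) = u i_{B'}(m)` for a unit `u ∈ A_M^×`"). Proof (not the printed one, see the module
docstring): the subgroup `H` of pairs of exponents of monomials of equal value is finitely
generated (`ℤ` is Noetherian); by Cor. 5.4.2 (`exists_isToricMonoid_forall_mem_centreLocalRing`)
and directedness (`exists_isToricMonoid_ge_ge`) there is a toric `M₀ ⊆ Λ°` beyond which
`A_M ∋ y'ᵢ^{±1}, u(gₗ)^{±1}` and `A'_M ∋ yᵢ^{±1}, u(gₗ)^{±1}` for generators `gₗ` of `H`; then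
`centreLocalRing_le_of_mem` both ways gives `A_M = A'_M`, and `i_B(m) = u · i_{B'}(m)` with
`u = u(d, d')⁻¹ ∈ A_M^×`.
[cite: Temkin2013, Prop. 5.4.3 (p. 57 of arXiv:0804.1554v3)] -/
theorem Temkin2013_Prop543_holds : Temkin2013_Prop543 := by
  intro k K _ _ _ hfg O hk hD E F x y hB E' F' x' y' hB'
  classical
  -- the subgroup `H` of pairs of exponents of equal value, and generators of it
  let H : Submodule ℤ ((Fin E →₀ ℤ) × (Fin E' →₀ ℤ)) :=
    { carrier := {p | O.valuation (p.1.prod fun j (n : ℤ) => x j ^ n) =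
        O.valuation (p.2.prod fun j (n : ℤ) => x' j ^ n)}
      add_mem' := fun {p q} hp hq => by
        simp only [Set.mem_setOf_eq, Prod.fst_add, Prod.snd_add] at hp hq ⊢
        rw [lmonomial_add x hB.ne_zero, lmonomial_add x' hB'.ne_zero, map_mul, map_mul, hp, hq]
      zero_mem' := by simp
      smul_mem' := fun c p hp => by
        simp only [Set.mem_setOf_eq, Prod.smul_fst, Prod.smul_snd] at hp ⊢
        rw [lmonomial_zsmul x hB.ne_zero, lmonomial_zsmul x' hB'.ne_zero, map_zpow₀, map_zpow₀,
          hp] }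
  have hH : ∀ p, p ∈ H ↔ O.valuation (p.1.prod fun j (n : ℤ) => x j ^ n) =
      O.valuation (p.2.prod fun j (n : ℤ) => x' j ^ n) := fun p => Iff.rfl
  obtain ⟨r, g, hg⟩ :=
    Submodule.fg_iff_exists_fin_generating_family.mp (IsNoetherian.noetherian H)
  have hgen : ∀ p ∈ H, ∃ c : Fin r → ℤ, ∑ i, c i • g i = p := fun p hp => by
    rw [← hg, Submodule.mem_span_range_iff_exists_fun] at hp
    exact hp
  have hgmem : ∀ i, g i ∈ H := fun i => hg ▸ Submodule.subset_span ⟨i, rfl⟩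
  -- the units `u(gᵢ)`
  set u : Fin r → K := fun i =>
    ((g i).2.prod fun j (n : ℤ) => x' j ^ n) / (g i).1.prod fun j (n : ℤ) => x j ^ n with hu
  have hu1 : ∀ i, O.valuation (u i) = 1 := fun i => by
    rw [hu, map_div₀, ← (hH _).mp (hgmem i)]
    exact div_self (valuation_ne_zero_of_ne_zero O (lmonomial_ne_zero x hB.ne_zero _))
  have huO : ∀ i, u i ∈ O := fun i => (O.valuation_le_one_iff _).mp (hu1 i).le
  have huO' : ∀ i, (u i)⁻¹ ∈ O := fun i => by
    rw [← O.valuation_le_one_iff, map_inv₀, hu1, inv_one]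
  have hyO' : ∀ {ι : Type} (w : ι → O), (∀ i, O.valuation (w i : K) = 1) →
      ∀ i, (w i : K)⁻¹ ∈ O := fun w hw i => by
    rw [← O.valuation_le_one_iff, map_inv₀, hw, inv_one]
  -- in any subalgebra containing the `u(gᵢ)^{±1}`, all the `u(d, d')` lie
  have hratio : ∀ A : Subalgebra k K, (∀ i, u i ∈ A ∧ (u i)⁻¹ ∈ A) →
      ∀ (d : Fin E →₀ ℤ) (d' : Fin E' →₀ ℤ),
        O.valuation (d.prod fun j (n : ℤ) => x j ^ n) =
          O.valuation (d'.prod fun j (n : ℤ) => x' j ^ n) →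
        (d'.prod fun j (n : ℤ) => x' j ^ n) / (d.prod fun j (n : ℤ) => x j ^ n) ∈ A := by
    intro A hA d d' h
    obtain ⟨c, hc⟩ := hgen (d, d') h
    have key := lmonomial_div_sum_zsmul x x' hB.ne_zero hB'.ne_zero g c (d, d') hc
    rw [key]
    exact prod_zpow_mem_of_inv_mem hA c
  -- the finite sets fed to Cor. 5.4.2
  set U : Finset K := Finset.univ.image u ∪ Finset.univ.image fun i => (u i)⁻¹ with hU
  have hUO : ∀ z ∈ U, z ∈ O := by
    intro z hz
    rcases Finset.mem_union.mp hz with hz | hz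
    · obtain ⟨i, -, rfl⟩ := Finset.mem_image.mp hz; exact huO i
    · obtain ⟨i, -, rfl⟩ := Finset.mem_image.mp hz; exact huO' i
  have huU : ∀ i, u i ∈ U := fun i =>
    Finset.mem_union_left _ (Finset.mem_image_of_mem u (Finset.mem_univ i))
  have huU' : ∀ i, (u i)⁻¹ ∈ U := fun i =>
    Finset.mem_union_right _ (Finset.mem_image_of_mem (fun i => (u i)⁻¹) (Finset.mem_univ i))
  set Z : Finset K := U ∪ ((Finset.univ.image fun i => (y' i : K)) ∪
    Finset.univ.image fun i => (y' i : K)⁻¹) with hZ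
  set Z' : Finset K := U ∪ ((Finset.univ.image fun i => (y i : K)) ∪
    Finset.univ.image fun i => (y i : K)⁻¹) with hZ'
  have hZO : ∀ z ∈ Z, z ∈ O := by
    intro z hz
    rcases Finset.mem_union.mp hz with hz | hz
    · exact hUO z hz
    rcases Finset.mem_union.mp hz with hz | hz
    · obtain ⟨i, -, rfl⟩ := Finset.mem_image.mp hz; exact (y' i).2
    · obtain ⟨i, -, rfl⟩ := Finset.mem_image.mp hz; exact hyO' y' hB'.valuation_eq_one i
  have hZ'O : ∀ z ∈ Z', z ∈ O := by
    intro z hz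
    rcases Finset.mem_union.mp hz with hz | hz
    · exact hUO z hz
    rcases Finset.mem_union.mp hz with hz | hz
    · obtain ⟨i, -, rfl⟩ := Finset.mem_image.mp hz; exact (y i).2
    · obtain ⟨i, -, rfl⟩ := Finset.mem_image.mp hz; exact hyO' y hB.valuation_eq_one i
  -- Cor. 5.4.2 for `B` and for `B'`, and a common threshold `M₀`
  obtain ⟨M₁, hM₁t, hM₁le, -, hM₁⟩ :=
    exists_isToricMonoid_forall_mem_centreLocalRing hfg O hk hD x y hB Z hZO
  obtain ⟨M₂, hM₂t, hM₂le, -, hM₂⟩ :=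
    exists_isToricMonoid_forall_mem_centreLocalRing hfg O hk hD x' y' hB' Z' hZ'O
  obtain ⟨M₀, hM₀t, hM₀le, h₁₀, h₂₀⟩ :=
    exists_isToricMonoid_ge_ge O hfg hk hD hM₁t.1 hM₁le hM₂t.1 hM₂le
  refine ⟨M₀, hM₀t, hM₀le, fun M _ hM₀M _ => ?_⟩
  set A := centreLocalRing O (nrAlg (toricChart (k := k) O x y M)) with hA
  set A' := centreLocalRing O (nrAlg (toricChart (k := k) O x' y' M)) with hA'
  have hZA : ∀ z ∈ Z, z ∈ A := hM₁ M (h₁₀.trans hM₀M)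
  have hZ'A' : ∀ z ∈ Z', z ∈ A' := hM₂ M (h₂₀.trans hM₀M)
  have huA : ∀ i, u i ∈ A ∧ (u i)⁻¹ ∈ A := fun i =>
    ⟨hZA _ (Finset.mem_union_left _ (huU i)), hZA _ (Finset.mem_union_left _ (huU' i))⟩
  have huA' : ∀ i, u i ∈ A' ∧ (u i)⁻¹ ∈ A' := fun i =>
    ⟨hZ'A' _ (Finset.mem_union_left _ (huU i)), hZ'A' _ (Finset.mem_union_left _ (huU' i))⟩
  -- the units `u(d, d')` lie in `A`, their inverses `u'(d', d)` in `A'`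
  have hrA := hratio A huA
  have hrA' : ∀ (d' : Fin E' →₀ ℤ) (d : Fin E →₀ ℤ),
      O.valuation (d'.prod fun j (n : ℤ) => x' j ^ n) =
        O.valuation (d.prod fun j (n : ℤ) => x j ^ n) →
      (d.prod fun j (n : ℤ) => x j ^ n) / (d'.prod fun j (n : ℤ) => x' j ^ n) ∈ A' := by
    intro d' d h
    rw [← inv_div]
    refine inv_mem_centreLocalRing_of_valuation_eq_one (hratio A' huA' d d' h.symm) ?_
    rw [map_div₀, h]
    exact div_self (valuation_ne_zero_of_ne_zero O (lmonomial_ne_zero x hB.ne_zero _))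
  -- the two inclusions
  have hle : A' ≤ A := centreLocalRing_le_of_mem hB hB'.ne_zero M
    (fun i => ⟨hZA _ (Finset.mem_union_right _ (Finset.mem_union_left _
        (Finset.mem_image_of_mem (fun i => (y' i : K)) (Finset.mem_univ i)))),
      hZA _ (Finset.mem_union_right _ (Finset.mem_union_right _
        (Finset.mem_image_of_mem (fun i => (y' i : K)⁻¹) (Finset.mem_univ i))))⟩) hrA
  have hge : A ≤ A' := centreLocalRing_le_of_mem hB' hB.ne_zero M
    (fun i => ⟨hZ'A' _ (Finset.mem_union_right _ (Finset.mem_union_left _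
        (Finset.mem_image_of_mem (fun i => (y i : K)) (Finset.mem_univ i)))),
      hZ'A' _ (Finset.mem_union_right _ (Finset.mem_union_right _
        (Finset.mem_image_of_mem (fun i => (y i : K)⁻¹) (Finset.mem_univ i))))⟩) hrA'
  refine ⟨le_antisymm hge hle, fun d d' hdd' _ => ?_⟩
  -- `i_B(m) = u · i_{B'}(m)` with `u = u(d, d')⁻¹`
  have h1 : O.valuation
      ((d'.prod fun j (n : ℤ) => x' j ^ n) / d.prod fun j (n : ℤ) => x j ^ n) = 1 := by
    rw [map_div₀, hdd']
    exact div_self (valuation_ne_zero_of_ne_zero O (lmonomial_ne_zero x' hB'.ne_zero _))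
  refine ⟨((d'.prod fun j (n : ℤ) => x' j ^ n) / d.prod fun j (n : ℤ) => x j ^ n)⁻¹,
    inv_mem_centreLocalRing_of_valuation_eq_one (hrA _ _ hdd') h1,
    by rw [inv_inv]; exact hrA _ _ hdd', ?_⟩
  rw [inv_div, div_mul_cancel₀ _ (lmonomial_ne_zero x' hB'.ne_zero d')]

end Literature.AlgebraicGeometry.Resolution

end
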